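import Summits.ResolutionOfSingularities.ResolutionOfSingularities.Theorems.PurelyInseparableDim4ResConeCInfTranslatedStepPrime
import HarnessLib
import HarnessLib.Audit.Tags

/-!
# Purely inseparable four-folds — the LETTER-CHANGE LAYER LEMMA of the flagless branch, every prime: at a letter change κ → o of
# a FLAGLESS light-pair power-cone chain the pre-state has NO residual monomial of degree `d + 1` with contact exponent `≤ d − 2`
# (cell `res-dim4-pi`, K2(p) lane, power-cone light-pair line, flagless branch, FILE ♯2)

[OURS · counted 0 · cell `res-dim4-pi` · K2(p) lane (holder res-dim4-p-12 g5, ruling g5-23: «reshape the flag» = MEMO FLAGLESS♯); seat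
res-dim4-p-3 g6 (MEMO `res-dim4-p-3/MEMO-g6-FLAGLESS-SHARP.md` §2, bus 2026-08-29 13:55Z).]  Nothing here proves K2(p) for any `p`, any
TAIL(p, p−1, 3), `NoIsolatedTrap p p`, the Cossart–Jannsen–Saito theorem or resolution of singularities in dimension ≥ 4 / characteristic `p`
— NOT proved.  AI kernel work, weaker than expert review.  Pure exponent algebra of OUR frame; kills nothing by itself.

F-exponents `(e_j, e_i, e_u, e_f)` of the slot letters `j, i`, the free letter `u`, the contact letter `f`; `d + 1 = p`; the chain's steps are
slot steps translated along `u` (FILE ♯1 `coeff_step_translate_u`: the child coefficient at `γ + (m − p)·e_j` is the binomial sum over the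
parent LINE `{|δ| = m, δ_i = γ_i, δ_f = γ_f}`).
* §1 `eq_of_line_of_apply_u_eq` (a line member is determined by its `u`-exponent), **`line_eq_zero_of_hasse_vanish`** — if every binomial
  (Hasse) sum `Σ_δ C(δ_u, J) β^{δ_u − J} coeff δ F`, `J ≤ E`, of a line whose members have `δ_u ≤ E` vanishes, the whole line vanishes
  (downward induction on `δ_u`: «a polynomial all of whose Hasse derivatives vanish at `β` is zero»).
* §2 **`exists_parent_of_mem_support_step_translate_u`** — BACKWARD LAW of the translated step: a child monomial `E` has a parent `δ` on its
  line (`|δ| = E_j + p`, `δ_i = E_i`, `δ_f = E_f`, `δ_u ≥ E_u`); `ledger_step_translate_u` — hence the EXACT LEDGER («`e_f ≤ d − 1 ⇒ e_j, e_i ≥ 2`»)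
  passes from a straight parent of order `d + 2` to the child, and children with `e_j = 2` («residual `κ`-exponent 1») have degree `≤ d + 3`.
* §3 **`letterChange_layer_prime`** (MEMO (LC)) — parent `s` straight of order `d + 2` with the exact ledger; `s₁ = κ-step (β)` and
  `s₂ = o-step (β′)` of `s₁` both IN REGIME (every monomial of degree `≥ d + 3` except the cone `x_j x_i x_f^d`); `s₁` FLAGLESS (no
  `x_j²x_i²x_u^{d−1−c}x_f^{c}`, `c + 2 ≤ d` — by ♯1 `coeff_flag_step_translate_u` the same as `s` flagless); THEN `s` has no monomial of degree
  `d + 3` with `e_f + 2 ≤ d`.  Proof: the `e_j = 2` monomials of `s₁` sit on `o`-lines topped by a flag of `s₁` (zero) whose lower Hasse sums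
  are coefficients of `s₂` below degree `d + 3` (zero): §1 kills them; they are exactly the Hasse sums of the degree-`(d+3)` `κ`-lines of `s`:
  §1 again.
[cite: Hauser2010, §§F–G] [cite: CossartJannsenSaito2020, Lemma 13.2, Thm. 3.14]
bears_on: LADDER-RESOLUTION:D157-DOOR2 (res-dim4-pi · K2(p) · power cones · flagless branch ♯2).  Supports
stmt-ResolutionOfSingularities-16155 (helper).
-/

set_option linter.dupNamespace false -- mandated namespace of this single-conjunct summit

noncomputable section

namespace Summit.ResolutionOfSingularities.ResolutionOfSingularities.Theorems.PIDim4

namespace ResCone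

open MvPolynomial Finset
open Literature.AlgebraicGeometry.Resolution
open Literature.AlgebraicGeometry.Resolution.CentreBlowup
open Literature.AlgebraicGeometry.Resolution.Hauser2010
open Literature.AlgebraicGeometry.Resolution.HauserPerlega2019

variable {K : Type} [Field K]

section Line

variable {j i u f : Fin 4} (hji : j ≠ i) (hju : j ≠ u) (hjf : j ≠ f) (hiu : i ≠ u) (hif : i ≠ f) (huf : u ≠ f)
include hji hju hjf hiu hif huf

/-! ## 1. A line all of whose Hasse sums vanish is empty -/

/-- Two members of one line (`|δ| = m`, `δ_i`, `δ_f` frozen) with the same `u`-exponent coincide. [OURS · bookkeeping] -/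
theorem eq_of_line_of_apply_u_eq {m : ℕ} {δ δ' : Fin 4 →₀ ℕ} (hδ : δ.degree = m) (hδ' : δ'.degree = m)
    (hi : δ i = δ' i) (hf : δ f = δ' f) (hu : δ u = δ' u) : δ = δ' := by
  have h1 := degree_eq_quad hji hju hjf hiu hif huf δ
  have h2 := degree_eq_quad hji hju hjf hiu hif huf δ'
  have hj : δ j = δ' j := by omega
  rw [eq_sum_single_four hji hju hjf hiu hif huf δ, eq_sum_single_four hji hju hjf hiu hif huf δ', hj, hi, hu, hf]

/-- **A LINE ALL OF WHOSE HASSE SUMS VANISH IS EMPTY.**  On the line `{δ ∈ supp F : |δ| = m, δ_i = b₀, δ_f = c₀}` suppose every member has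
`δ_u ≤ E` and for every `J ≤ E` the binomial sum `Σ_δ C(δ_u, J)·β^{δ_u − J}·coeff δ F` vanishes.  Then every member has coefficient `0`
(downward induction on `δ_u`: the sum for `J = δ_u` reads `coeff δ F + (higher members, already zero)`). [OURS] [folklore] -/
theorem line_eq_zero_of_hasse_vanish (F : MvPolynomial (Fin 4) K) (m b₀ c₀ : ℕ) (β : K) (E : ℕ)
    (htop : ∀ δ ∈ F.support, δ.degree = m → δ i = b₀ → δ f = c₀ → δ u ≤ E)
    (hvan : ∀ J, J ≤ E →
      ∑ δ ∈ F.support with (δ.degree = m ∧ δ i = b₀ ∧ δ f = c₀), ((δ u).choose J : K) * β ^ (δ u - J) * coeff δ F = 0) :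
    ∀ δ : Fin 4 →₀ ℕ, δ.degree = m → δ i = b₀ → δ f = c₀ → coeff δ F = 0 := by
  classical
  -- downward induction: every member with `E − k ≤ δ_u` vanishes
  suffices h : ∀ k, ∀ δ : Fin 4 →₀ ℕ, δ.degree = m → δ i = b₀ → δ f = c₀ → E - k ≤ δ u → coeff δ F = 0 by
    intro δ hm hi hf
    exact h E δ hm hi hf (by omega)
  intro k
  induction k with
  | zero =>
    intro δ hm hi hf hE
    by_contra hne
    have := htop δ (mem_support_iff.mpr hne) hm hi hf
    -- `δ_u = E`: use the sum for `J = E`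
    have hJ := hvan E le_rfl
    rw [Finset.sum_eq_single δ] at hJ
    · rw [show δ u = E by omega, Nat.choose_self, Nat.sub_self, pow_zero, Nat.cast_one, one_mul, one_mul] at hJ
      exact hne hJ
    · intro δ' hδ' hne'
      rw [Finset.mem_filter] at hδ'
      obtain ⟨hmem', hm', hi', hf'⟩ := hδ'
      have hle := htop δ' hmem' hm' hi' hf'
      rcases Nat.lt_or_ge (δ' u) E with hlt | hge
      · rw [Nat.choose_eq_zero_of_lt hlt, Nat.cast_zero, zero_mul, zero_mul]
      · exfalso
        exact hne' (eq_of_line_of_apply_u_eq hji hju hjf hiu hif huf hm' hm (hi'.trans hi.symm) (hf'.trans hf.symm)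
          (by omega))
    · intro hnot
      exfalso
      exact hnot (Finset.mem_filter.mpr ⟨mem_support_iff.mpr hne, hm, hi, hf⟩)
  | succ k ih =>
    intro δ hm hi hf hE
    by_cases hlt : E - k ≤ δ u
    · exact ih δ hm hi hf hlt
    · -- `δ_u = E − k − 1 < E − k`: the sum for `J = δ_u`
      by_contra hne
      have hJ := hvan (δ u) (by omega)
      rw [Finset.sum_eq_single δ] at hJ
      · rw [Nat.choose_self, Nat.sub_self, pow_zero, Nat.cast_one, one_mul, one_mul] at hJ
        exact hne hJ
      · intro δ' hδ' hne'
        rw [Finset.mem_filter] at hδ'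
        obtain ⟨hmem', hm', hi', hf'⟩ := hδ'
        rcases Nat.lt_or_ge (δ' u) (δ u) with hlt' | hge
        · rw [Nat.choose_eq_zero_of_lt hlt', Nat.cast_zero, zero_mul, zero_mul]
        · rcases Nat.eq_or_lt_of_le hge with heq | hgt
          · exfalso
            exact hne' (eq_of_line_of_apply_u_eq hji hju hjf hiu hif huf hm' hm (hi'.trans hi.symm) (hf'.trans hf.symm)
              heq.symm)
          · rw [ih δ' hm' hi' hf' (by omega), mul_zero]
      · intro hnot
        exfalso
        exact hnot (Finset.mem_filter.mpr ⟨mem_support_iff.mpr hne, hm, hi, hf⟩)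

end Line

/-! ## 2. Backward law and ledger transport for the translated slot step -/

section Step

variable [DecidableEq K]
variable {j i u f : Fin 4} (hji : j ≠ i) (hju : j ≠ u) (hjf : j ≠ f) (hiu : i ≠ u) (hif : i ≠ f) (huf : u ≠ f)
include hji hju hjf hiu hif huf

/-- **BACKWARD LAW of the translated slot step, every prime**: a monomial `E` present at the child of the slot step in the chart of `j`
translated by `β·e_u` has a parent `δ` on its line: `|δ| = E_j + p`, `δ_i = E_i`, `δ_f = E_f`, `E_u ≤ δ_u`. [OURS] [cite: Hauser2010, §§F–G] -/
theorem exists_parent_of_mem_support_step_translate_u (p : ℕ) (s : State K) (hq : ((p : ℕ) : ℕ∞) ≤ ordAlong Finset.univ s.F)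
    (β : K) {E : Fin 4 →₀ ℕ} (hE : E ∈ (CentreBlowup.step p Finset.univ j (Function.update (0 : Fin 4 → K) u β) s).F.support) :
    ∃ δ ∈ s.F.support, δ.degree = E j + p ∧ δ i = E i ∧ δ f = E f ∧ E u ≤ δ u := by
  classical
  have hcoeff := mem_support_iff.mp hE
  have hnp : ¬ IsPthPowerExponent p E := by
    intro hP
    apply hcoeff
    show coeff E (deletePthPowers p (pointTransform p Finset.univ j _ s)) = 0
    rw [coeff_deletePthPowers, if_pos hP]
  set γ : Fin 4 →₀ ℕ := E.erase j with hγdef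
  have hγj : γ j = 0 := by rw [hγdef, Finsupp.erase_same]
  have hEγ : E = γ + Finsupp.single j (E j + p - p) := by
    rw [Nat.add_sub_cancel, hγdef, Finsupp.erase_add_single]
  have hγi : γ i = E i := by rw [hγdef, Finsupp.erase_ne hji.symm]
  have hγu : γ u = E u := by rw [hγdef, Finsupp.erase_ne hju.symm]
  have hγf : γ f = E f := by rw [hγdef, Finsupp.erase_ne hjf.symm]
  rw [hEγ] at hcoeff hnp
  rw [coeff_step_translate_u hji hju hjf hiu hif huf p s hq β (Nat.le_add_left p (E j)) γ hγj hnp] at hcoeff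
  obtain ⟨δ, hδ, hne⟩ := Finset.exists_ne_zero_of_sum_ne_zero hcoeff
  rw [Finset.mem_filter] at hδ
  obtain ⟨hmem, hm, hi, hf⟩ := hδ
  refine ⟨δ, hmem, hm, hi.trans hγi, hf.trans hγf, ?_⟩
  by_contra hlt
  apply hne
  rw [Nat.choose_eq_zero_of_lt (by rw [hγu]; omega), Nat.cast_zero, zero_mul, zero_mul]

/-- **LEDGER TRANSPORT, translated slot step** (`d + 1 = p`): from a parent of order `≥ d + 2` whose only degree-`(d+2)` monomial is the
cone `x_j x_i x_f^d` (STRAIGHT) and which has the exact ledger «`e_f ≤ d − 1 ⇒ e_j ≥ 2 ∧ e_i ≥ 2`», the child of the slot step in the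
chart of `j` translated by ANY `β·e_u` again has the exact ledger, and its monomials with `e_j = 2` and `e_f ≤ d − 1` (residual
`κ`-exponent `1`) have degree `≤ d + 3`. [OURS] [cite: CossartJannsenSaito2020, Lemma 13.2] -/
theorem ledger_step_translate_u (p : ℕ) {d : ℕ} (hdp : d + 1 = p) (hd2 : 2 ≤ d) (s : State K)
    (hq : ((p : ℕ) : ℕ∞) ≤ ordAlong Finset.univ s.F) (h6 : ∀ e ∈ s.F.support, d + 2 ≤ e.degree)
    (hstraight : ∀ e ∈ s.F.support, e.degree = d + 2 →
      e = Finsupp.single j 1 + Finsupp.single i 1 + Finsupp.single u 0 + Finsupp.single f d)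
    (hled : ∀ e ∈ s.F.support, e f ≤ d - 1 → 2 ≤ e j ∧ 2 ≤ e i) (β : K) :
    (∀ E ∈ (CentreBlowup.step p Finset.univ j (Function.update (0 : Fin 4 → K) u β) s).F.support,
        E f ≤ d - 1 → 2 ≤ E j ∧ 2 ≤ E i) ∧
      (∀ E ∈ (CentreBlowup.step p Finset.univ j (Function.update (0 : Fin 4 → K) u β) s).F.support,
        E f ≤ d - 1 → E j = 2 → E.degree ≤ d + 3) := by
  have key : ∀ E ∈ (CentreBlowup.step p Finset.univ j (Function.update (0 : Fin 4 → K) u β) s).F.support, E f ≤ d - 1 →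
      ∃ δ ∈ s.F.support, δ.degree = E j + p ∧ δ i = E i ∧ δ f = E f ∧ E u ≤ δ u ∧ 2 ≤ δ j ∧ 2 ≤ δ i ∧ d + 3 ≤ δ.degree := by
    intro E hE hEf
    obtain ⟨δ, hmem, hm, hi, hf, hu⟩ := exists_parent_of_mem_support_step_translate_u hji hju hjf hiu hif huf p s hq β hE
    have hled' := hled δ hmem (by rw [hf]; exact hEf)
    refine ⟨δ, hmem, hm, hi, hf, hu, hled'.1, hled'.2, ?_⟩
    have h6' := h6 δ hmem
    rcases Nat.eq_or_lt_of_le h6' with heq | hlt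
    · exfalso
      have hc := hstraight δ hmem heq.symm
      have := (quad_apply hji hju hjf hiu hif huf 1 1 0 d).2.2.2
      rw [← hc] at this
      rw [this] at hf
      omega
    · omega
  refine ⟨fun E hE hEf => ?_, fun E hE hEf hEj => ?_⟩
  · obtain ⟨δ, -, hm, hi, -, -, -, hδi, hdeg⟩ := key E hE hEf
    exact ⟨by omega, by rw [← hi]; exact hδi⟩
  · obtain ⟨δ, -, hm, hi, hf, hu, hδj, -, -⟩ := key E hE hEf
    have h1 := degree_eq_quad hji hju hjf hiu hif huf δ
    have h2 := degree_eq_quad hji hju hjf hiu hif huf E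
    omega

/-! ## 3. The letter-change layer lemma -/

/-- **THE LETTER-CHANGE LAYER LEMMA, every prime** (MEMO (LC); `d + 1 = p`, `2 ≤ d`).  Parent `s`: order `≥ d + 2`, straight, exact
ledger.  `s₁` = slot step in the chart of `j` translated by `β·e_u`, `s₂` = slot step of `s₁` in the chart of the OTHER slot `i` translated
by `β′·e_u`, both IN REGIME (every monomial has degree `≥ d + 3` or is the cone) and `s₁` FLAGLESS (`coeff x_j²x_i²x_u^{d−1−c}x_f^c s₁.F = 0`
for `c + 2 ≤ d`).  Then the parent has NO monomial of degree `d + 3` with contact exponent `e_f ≤ d − 2` (residual degree `d + 1`, `c ≤ d − 2`).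
[OURS] [cite: Hauser2010, §§F–G] [cite: CossartJannsenSaito2020, Thm. 3.14] -/
theorem letterChange_layer_prime (p : ℕ) [hp : Fact p.Prime] {d : ℕ} (hdp : d + 1 = p) (hd2 : 2 ≤ d) (s : State K)
    (hq : ((p : ℕ) : ℕ∞) ≤ ordAlong Finset.univ s.F) (h6 : ∀ e ∈ s.F.support, d + 2 ≤ e.degree)
    (hstraight : ∀ e ∈ s.F.support, e.degree = d + 2 →
      e = Finsupp.single j 1 + Finsupp.single i 1 + Finsupp.single u 0 + Finsupp.single f d)
    (hled : ∀ e ∈ s.F.support, e f ≤ d - 1 → 2 ≤ e j ∧ 2 ≤ e i) (β β' : K)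
    (hq₁ : ((p : ℕ) : ℕ∞) ≤ ordAlong Finset.univ (CentreBlowup.step p Finset.univ j (Function.update (0 : Fin 4 → K) u β) s).F)
    (hreg₁ : ∀ E ∈ (CentreBlowup.step p Finset.univ j (Function.update (0 : Fin 4 → K) u β) s).F.support,
      d + 3 ≤ E.degree ∨ E = Finsupp.single j 1 + Finsupp.single i 1 + Finsupp.single u 0 + Finsupp.single f d)
    (hflag₁ : ∀ c, c + 2 ≤ d → coeff (Finsupp.single j 2 + Finsupp.single i 2 + Finsupp.single u (d - 1 - c) + Finsupp.single f c)
      (CentreBlowup.step p Finset.univ j (Function.update (0 : Fin 4 → K) u β) s).F = 0)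
    (hreg₂ : ∀ E ∈ (CentreBlowup.step p Finset.univ i (Function.update (0 : Fin 4 → K) u β')
        (CentreBlowup.step p Finset.univ j (Function.update (0 : Fin 4 → K) u β) s)).F.support,
      d + 3 ≤ E.degree ∨ E = Finsupp.single j 1 + Finsupp.single i 1 + Finsupp.single u 0 + Finsupp.single f d) :
    ∀ E : Fin 4 →₀ ℕ, E.degree = d + 3 → E f + 2 ≤ d → coeff E s.F = 0 := by
  classical
  set s₁ := CentreBlowup.step p Finset.univ j (Function.update (0 : Fin 4 → K) u β) s with hs₁
  set s₂ := CentreBlowup.step p Finset.univ i (Function.update (0 : Fin 4 → K) u β') s₁ with hs₂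
  have hp3 : 3 ≤ p := by have := hp.out.two_le; omega
  obtain ⟨hled₁, hdeg₁⟩ := ledger_step_translate_u hji hju hjf hiu hif huf p hdp hd2 s hq h6 hstraight hled β
  -- STEP 1: every monomial of `s₁` with `e_j = 2` and `e_f + 2 ≤ d` vanishes.
  have step1 : ∀ E₁ : Fin 4 →₀ ℕ, E₁ j = 2 → E₁ f + 2 ≤ d → coeff E₁ s₁.F = 0 := by
    intro E₁ hE₁j hE₁f
    by_contra hne
    have hmem : E₁ ∈ s₁.F.support := mem_support_iff.mpr hne
    have hdeg : E₁.degree = d + 3 := by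
      have hle := hdeg₁ E₁ hmem (by omega) hE₁j
      rcases hreg₁ E₁ hmem with hge | hc
      · omega
      · exfalso
        have := (quad_apply hji hju hjf hiu hif huf 1 1 0 d).1
        rw [← hc, hE₁j] at this
        omega
    set c := E₁ f with hc
    -- the `o`-line of `E₁` in `s₁` (frozen `e_j = 2`, `e_f = c`, degree `d + 3`); members have `e_i ≥ 2`, so `e_u ≤ d − 1 − c`
    have htop : ∀ δ ∈ s₁.F.support, δ.degree = d + 3 → δ j = 2 → δ f = c → δ u ≤ d - 1 - c := by
      intro δ hδ hm hj' hf'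
      have h2 := (hled₁ δ hδ (by omega)).2
      have := degree_eq_quad hji hju hjf hiu hif huf δ
      omega
    have hvan : ∀ J, J ≤ d - 1 - c →
        ∑ δ ∈ s₁.F.support with (δ.degree = d + 3 ∧ δ j = 2 ∧ δ f = c),
          ((δ u).choose J : K) * β' ^ (δ u - J) * coeff δ s₁.F = 0 := by
      intro J hJ
      set γ' : Fin 4 →₀ ℕ := Finsupp.single j 2 + Finsupp.single u J + Finsupp.single f c with hγ'
      have hγ'i : γ' i = 0 := by
        rw [hγ', Finsupp.add_apply, Finsupp.add_apply, Finsupp.single_eq_of_ne hji.symm, Finsupp.single_eq_of_ne hiu,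
          Finsupp.single_eq_of_ne hif]; simp
      have hγ'j : γ' j = 2 := by
        rw [hγ', Finsupp.add_apply, Finsupp.add_apply, Finsupp.single_eq_same, Finsupp.single_eq_of_ne hju,
          Finsupp.single_eq_of_ne hjf]; simp
      have hγ'u : γ' u = J := by
        rw [hγ', Finsupp.add_apply, Finsupp.add_apply, Finsupp.single_eq_of_ne hju.symm, Finsupp.single_eq_same,
          Finsupp.single_eq_of_ne huf]; simp
      have hγ'f : γ' f = c := by
        rw [hγ', Finsupp.add_apply, Finsupp.add_apply, Finsupp.single_eq_of_ne hjf.symm, Finsupp.single_eq_of_ne huf.symm,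
          Finsupp.single_eq_same]; simp
      have hnp : ¬ IsPthPowerExponent p (γ' + Finsupp.single i (d + 3 - p)) := by
        rw [isPthPowerExponent_iff]
        intro h
        have h2 := h i
        rw [Finsupp.add_apply, hγ'i, zero_add, Finsupp.single_eq_same, show d + 3 - p = 2 by omega] at h2
        have := Nat.le_of_dvd (by norm_num) h2
        omega
      have key := coeff_step_translate_u hji.symm hiu hif hju hjf huf p s₁ hq₁ β' (show p ≤ d + 3 by omega) γ' hγ'i hnp
      simp only [hγ'j, hγ'u, hγ'f] at key
      rw [← key]
      -- the child exponent: below degree `d + 3` unless `J` is the top, where it is a FLAG of `s₂`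
      rcases Nat.lt_or_ge J (d - 1 - c) with hlt | hge
      · refine notMem_support_iff.mp fun hmem₂ => ?_
        rcases hreg₂ _ hmem₂ with hge | hcone
        · have hdegγ : (γ' + Finsupp.single i (d + 3 - p)).degree = 2 + J + c + (d + 3 - p) := by
            rw [map_add, Finsupp.degree_single, hγ', map_add, map_add, Finsupp.degree_single, Finsupp.degree_single,
              Finsupp.degree_single]
          rw [hdegγ] at hge
          omega
        · have hj2 : (γ' + Finsupp.single i (d + 3 - p)) j =
              (Finsupp.single j 1 + Finsupp.single i 1 + Finsupp.single u 0 + Finsupp.single f d : Fin 4 →₀ ℕ) j := by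
            rw [hcone]
          rw [Finsupp.add_apply, hγ'j, Finsupp.single_eq_of_ne hji, (quad_apply hji hju hjf hiu hif huf 1 1 0 d).1] at hj2
          omega
      · have hJ' : J = d - 1 - c := le_antisymm hJ hge
        have hexp : γ' + Finsupp.single i (d + 3 - p) =
            Finsupp.single i 2 + Finsupp.single j 2 + Finsupp.single u (d - 1 - c) + Finsupp.single f c := by
          rw [show d + 3 - p = 2 by omega, hγ', hJ']
          abel
        rw [hexp, coeff_flag_step_translate_u hji.symm hiu hif hju hjf huf p hdp hd2 s₁ hq₁
          (fun e he hef => (hled₁ e he hef).2) β' (show c + 2 ≤ d by omega), ← gameExp_swap, hflag₁ c (by omega)]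
    exact hne (line_eq_zero_of_hasse_vanish hji.symm hiu hif hju hjf huf s₁.F (d + 3) 2 c β' (d - 1 - c) htop hvan E₁ hdeg
      hE₁j rfl)
  -- STEP 2: the degree-`(d+3)` `κ`-lines of `s` with `e_f + 2 ≤ d` have all their Hasse sums among the STEP-1 coefficients.
  intro E hEdeg hEf
  by_contra hne
  have hmem : E ∈ s.F.support := mem_support_iff.mpr hne
  obtain ⟨hEj, hEi⟩ := hled E hmem (by omega)
  have htop : ∀ δ ∈ s.F.support, δ.degree = d + 3 → δ i = E i → δ f = E f → δ u ≤ d + 1 - E i - E f := by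
    intro δ hδ hm hi' hf'
    have h2 := (hled δ hδ (by omega)).1
    have := degree_eq_quad hji hju hjf hiu hif huf δ
    omega
  have hvan : ∀ J, J ≤ d + 1 - E i - E f →
      ∑ δ ∈ s.F.support with (δ.degree = d + 3 ∧ δ i = E i ∧ δ f = E f),
        ((δ u).choose J : K) * β ^ (δ u - J) * coeff δ s.F = 0 := by
    intro J hJ
    set γ : Fin 4 →₀ ℕ := Finsupp.single i (E i) + Finsupp.single u J + Finsupp.single f (E f) with hγ
    have hγj : γ j = 0 := by
      rw [hγ, Finsupp.add_apply, Finsupp.add_apply, Finsupp.single_eq_of_ne hji, Finsupp.single_eq_of_ne hju,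
        Finsupp.single_eq_of_ne hjf]; simp
    have hγi : γ i = E i := by
      rw [hγ, Finsupp.add_apply, Finsupp.add_apply, Finsupp.single_eq_same, Finsupp.single_eq_of_ne hiu,
        Finsupp.single_eq_of_ne hif]; simp
    have hγu : γ u = J := by
      rw [hγ, Finsupp.add_apply, Finsupp.add_apply, Finsupp.single_eq_of_ne hiu.symm, Finsupp.single_eq_same,
        Finsupp.single_eq_of_ne huf]; simp
    have hγf : γ f = E f := by
      rw [hγ, Finsupp.add_apply, Finsupp.add_apply, Finsupp.single_eq_of_ne hif.symm, Finsupp.single_eq_of_ne huf.symm,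
        Finsupp.single_eq_same]; simp
    have hnp : ¬ IsPthPowerExponent p (γ + Finsupp.single j (d + 3 - p)) := by
      rw [isPthPowerExponent_iff]
      intro h
      have h2 := h j
      rw [Finsupp.add_apply, hγj, zero_add, Finsupp.single_eq_same, show d + 3 - p = 2 by omega] at h2
      have := Nat.le_of_dvd (by norm_num) h2
      omega
    have key := coeff_step_translate_u hji hju hjf hiu hif huf p s hq β (show p ≤ d + 3 by omega) γ hγj hnp
    simp only [hγi, hγu, hγf] at key
    rw [← key]
    refine step1 _ ?_ ?_
    · rw [Finsupp.add_apply, hγj, zero_add, Finsupp.single_eq_same]; omega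
    · rw [Finsupp.add_apply, hγf, Finsupp.single_eq_of_ne hjf.symm, add_zero]; exact hEf
  exact hne (line_eq_zero_of_hasse_vanish hji hju hjf hiu hif huf s.F (d + 3) (E i) (E f) β (d + 1 - E i - E f) htop hvan E
    hEdeg rfl rfl)

end Step

end ResCone

end Summit.ResolutionOfSingularities.ResolutionOfSingularities.Theorems.PIDim4
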